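import Literature.Probability.LatticeModels.DobrushinShlosmanContraction
import HarnessLib

/-!
# The Dobrushin–Shlosman window comparison: contraction under the averaged condition IN THE BULK ONLY

Companion of `DobrushinShlosmanContraction.lean`. There the received-sum hypothesis of the
Dobrushin–Shlosman finite-size criterion, `Σ_{c ∋ x} Σ_y k c y x ≤ γ₀ |{c ∋ x}|` (condition `C_V`, AVERAGED
over the positions of the window around the cell `x`), is assumed at EVERY cell `x`. When the comparison is
run on a finite piece `Λ` of an infinite system with the genuine windows `V + t ⊆ Λ` only (the infinite-volume
wrappers), the cells near the boundary of `Λ` lie in FEWER windows than a bulk cell, and in those windows they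
sit near the window's boundary: the averaged condition, which on `ℤ^d` holds by translation invariance for
bulk cells, genuinely FAILS there (this is the whole point of Dobrushin–Shlosman's averaging — a cell next to a
window face receives a boundary influence of order one). The per-window form of the tree's wrapper
(`DobrushinShlosmanUniqueness.lean`, hypothesis `Σ_y K c y x ≤ γ₀` for every `x ∈ win c`) sidesteps this but
is too strong for finite-volume MIXING inputs (Chatterjee 2021, Def. 2.3; Martinelli–Olivieri).

Observation proved here: the three-zone invariant of `DobrushinShlosman.iterate_step_le` uses the averaged
condition only at cells of POSITIVE profile (zone `ℓ ≥ 1`, where all windows are usable and the received sum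
contracts); in the zone `ℓ = 0` any CRUDE bound `Σ_{c ∋ x} Σ_y k c y x ≤ Γ` feeds the growth budget. Hence:

* `iterate_step_le_bulk` — `(step^m R) x ≤ R ((1 + ε(2Γ+1)/|ι|)^m θ^{ℓ x} + (1 − ε(1−γ₀)/|ι|)^m)` under
  `Σ_{c∋x} Σ_y k ≤ Γ` everywhere and `Σ_{c∋x} Σ_y k ≤ γ₀ |{c ∋ x}|` where `ℓ x ≠ 0`;
* `abs_sub_le_exp_bulk` — the comparison theorem `|E₁ F − E₂ F| ≤ 2 R e^{−κ L₀} Σ δ`,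
  `κ = (1−γ₀)²/(2(2Γ+1))`, constants free of `|ι|`.

With `Γ = γ₀ N⋆` these are the tree's `iterate_step_le` / `abs_sub_le_exp`. Theorems over explicit data, no
definitions.

References: R. L. Dobrushin, S. B. Shlosman, *Constructive criterion for the uniqueness of Gibbs field*
(1985), Thm. 1 (condition `C_V`); F. Martinelli, LNM 1717 (1999) §2.3–2.4 (finite-volume mixing ⇒
uniqueness via block dynamics); H. Föllmer, LNM 1362 (1988) Ch. I §2.
-/

open Finset

noncomputable section

namespace Literature.Probability.LatticeModels.DobrushinShlosman

variable {ι Ω : Type*} [Fintype ι] [DecidableEq ι]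
variable {R : ℝ} {Adm : (Ω → ℝ) → Prop} {Lip : (Ω → ℝ) → (ι → ℝ) → Prop} {T : ι → (Ω → ℝ) → (Ω → ℝ)}
  {win : ι → Finset ι} {k : ι → ι → ι → ℝ} {U : Finset ι} {E₁ E₂ : (Ω → ℝ) → ℝ}

/-! ### The pointwise bound for the averaged step, with an arbitrary received-sum bound -/

/-- **Pointwise bound for the averaged step** from ANY bound `Kx` on the received sum
`Σ_{c ∋ x} Σ_y k c y x` of the cell `x`: if `S ≥ 0` bounds `a y` for every `y` influencing `x` through a
usable window, then `step a x ≤ (1 − ε u_x/|ι|) a x + (ε/|ι|) Kx S`, `u_x` the number of usable centres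
around `x` (the tree's `step_le` is the case `Kx = γ₀ |{c ∋ x}|`). [cite: DobrushinShlosman1985, Theorem] -/
theorem step_le_of_received_le (hk : ∀ c y x, 0 ≤ k c y x) {ε : ℝ} (hε0 : 0 ≤ ε)
    {step : (ι → ℝ) → ι → ℝ}
    (hstep : ∀ a x, step a x = (1 - ε * U.card / Fintype.card ι) * a x +
      ε / Fintype.card ι * ∑ c ∈ U, (if x ∈ win c then ∑ y, k c y x * a y else a x))
    (a : ι → ℝ) (x : ι) {Kx : ℝ}
    (hsum : ∑ c ∈ Finset.univ.filter (fun c => x ∈ win c), ∑ y, k c y x ≤ Kx)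
    {S : ℝ} (hS0 : 0 ≤ S) (hS : ∀ c ∈ U, x ∈ win c → ∀ y, k c y x ≠ 0 → a y ≤ S) :
    step a x ≤ (1 - ε * (U.filter fun c => x ∈ win c).card / Fintype.card ι) * a x +
      ε / Fintype.card ι * Kx * S := by
  -- adapted from `DobrushinShlosman.step_le` (`γ₀ |{c ∋ x}|` ↦ `Kx`)
  have hq : 0 ≤ ε / Fintype.card ι := div_nonneg hε0 (Nat.cast_nonneg _)
  have hsplit : ∑ c ∈ U, (if x ∈ win c then ∑ y, k c y x * a y else a x) =
      ∑ c ∈ U.filter (fun c => x ∈ win c), ∑ y, k c y x * a y +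
        ((U.filter fun c => x ∉ win c).card : ℝ) * a x := by
    rw [← Finset.sum_filter_add_sum_filter_not U (fun c => x ∈ win c)]
    congr 1
    · exact Finset.sum_congr rfl fun c hc => by rw [if_pos (Finset.mem_filter.1 hc).2]
    · rw [← nsmul_eq_mul, ← Finset.sum_const]
      exact Finset.sum_congr rfl fun c hc => by rw [if_neg (Finset.mem_filter.1 hc).2]
  have hcard : ((U.filter fun c => x ∉ win c).card : ℝ) =
      U.card - (U.filter fun c => x ∈ win c).card := by
    have h := Finset.card_filter_add_card_filter_not (s := U) (fun c => x ∈ win c)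
    rw [eq_sub_iff_add_eq, add_comm]
    exact_mod_cast h
  have hinf : ∑ c ∈ U.filter (fun c => x ∈ win c), ∑ y, k c y x * a y ≤ Kx * S := by
    calc ∑ c ∈ U.filter (fun c => x ∈ win c), ∑ y, k c y x * a y
        ≤ ∑ c ∈ U.filter (fun c => x ∈ win c), ∑ y, k c y x * S := by
          refine Finset.sum_le_sum fun c hc => Finset.sum_le_sum fun y _ => ?_
          by_cases hk0 : k c y x = 0
          · rw [hk0, zero_mul, zero_mul]
          · exact mul_le_mul_of_nonneg_left
              (hS c (Finset.mem_filter.1 hc).1 (Finset.mem_filter.1 hc).2 y hk0) (hk c y x)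
      _ ≤ ∑ c ∈ Finset.univ.filter (fun c => x ∈ win c), ∑ y, k c y x * S := by
          refine Finset.sum_le_sum_of_subset_of_nonneg (fun c hc => ?_) fun c _ _ =>
            Finset.sum_nonneg fun y _ => mul_nonneg (hk c y x) hS0
          exact Finset.mem_filter.2 ⟨Finset.mem_univ _, (Finset.mem_filter.1 hc).2⟩
      _ = (∑ c ∈ Finset.univ.filter (fun c => x ∈ win c), ∑ y, k c y x) * S := by
          rw [Finset.sum_mul]; exact Finset.sum_congr rfl fun c _ => (Finset.sum_mul _ _ _).symm
      _ ≤ Kx * S := mul_le_mul_of_nonneg_right hsum hS0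
  rw [hstep, hsplit, hcard]
  have key := mul_le_mul_of_nonneg_left hinf hq
  have e : (1 - ε * U.card / Fintype.card ι) * a x + ε / Fintype.card ι *
      (∑ c ∈ U.filter (fun c => x ∈ win c), ∑ y, k c y x * a y +
        (U.card - ((U.filter fun c => x ∈ win c).card : ℝ)) * a x) =
      (1 - ε * (U.filter fun c => x ∈ win c).card / Fintype.card ι) * a x +
        ε / Fintype.card ι * ∑ c ∈ U.filter (fun c => x ∈ win c), ∑ y, k c y x * a y := by ring
  rw [e]
  linarith

/-! ### The three-zone invariant with the averaged condition in the bulk only -/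

omit [Fintype ι] [DecidableEq ι] in
/-- The algebra of the zone `ℓ = 0` with growth budget `Γ`: elementary real inequality (the tree's
`zone_zero_ineq` is the case `Γ = γ₀ N`). [folklore] -/
private theorem zone_zero_ineq_bulk {R P Q q γ₀ Γ G β s t : ℝ} (hR : 0 ≤ R) (hq : 0 ≤ q) (hγ₀ : 0 ≤ γ₀)
    (hΓ : 0 ≤ Γ) (hP : 1 ≤ P) (hQ0 : 0 ≤ Q) (hQ1 : Q ≤ 1)
    (hG : G = 1 + q * (2 * Γ + 1)) (hβ : β = 1 - q * (1 - γ₀))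
    (hs : s ≤ t + q * Γ * (R * (P + Q))) (ht : t ≤ R * (P + Q)) :
    s ≤ R * (P * G + Q * β) := by
  subst hG hβ
  have h3 : 0 ≤ R * (q * (Γ * (P - Q) + (P - Q) + γ₀ * Q)) :=
    mul_nonneg hR (mul_nonneg hq (by nlinarith))
  have h4 : 0 ≤ q * Γ := mul_nonneg hq hΓ
  have h5 : q * Γ * t ≤ q * Γ * (R * (P + Q)) := mul_le_mul_of_nonneg_left ht h4
  have e : R * (P * (1 + q * (2 * Γ + 1)) + Q * (1 - q * (1 - γ₀))) =
      R * (P + Q) + q * Γ * (R * (P + Q)) + R * (q * (Γ * (P - Q) + (P - Q) + γ₀ * Q)) := by ring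
  rw [e]
  linarith

/-- **The time-dependent three-zone invariant, bulk form**: under a crude received-sum bound
`Σ_{c∋x} Σ_y k c y x ≤ Γ` at EVERY cell and the averaged Dobrushin–Shlosman condition
`Σ_{c∋x} Σ_y k c y x ≤ γ₀ |{c ∋ x}|` at the cells of POSITIVE profile only (ratio `γ₀ ≤ θ ≤ 1`), every cell in
its own window, all centres around a cell of positive profile usable, and a profile `ℓ` dropping by at most one
from an interior cell to a cell influencing it, the iterates of the averaged step started at `R ≥ 0` satisfy
`(step^m R) x ≤ R ((1 + ε(2Γ+1)/|ι|)^m θ^{ℓ x} + (1 − ε(1−γ₀)/|ι|)^m)`.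
[cite: DobrushinShlosman1985, Theorem] -/
theorem iterate_step_le_bulk (hR : 0 ≤ R) (hk : ∀ c y x, 0 ≤ k c y x) {γ₀ θ ε Γ : ℝ}
    (hγ₀ : 0 ≤ γ₀) (hγ₁ : γ₀ ≤ 1) (hθ : γ₀ ≤ θ) (hθ1 : θ ≤ 1) (hε0 : 0 ≤ ε) (hε1 : ε ≤ 1) (hΓ : 0 ≤ Γ)
    {step : (ι → ℝ) → ι → ℝ} (hstep : ∀ a x, step a x = (1 - ε * U.card / Fintype.card ι) * a x +
      ε / Fintype.card ι * ∑ c ∈ U, (if x ∈ win c then ∑ y, k c y x * a y else a x))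
    (ℓ : ι → ℕ) (hU : ∀ x, ℓ x ≠ 0 → ∀ c, x ∈ win c → c ∈ U)
    (hℓ : ∀ c x y, x ∈ win c → k c y x ≠ 0 → ℓ x ≤ ℓ y + 1)
    (hsum0 : ∀ x, ∑ c ∈ Finset.univ.filter (fun c => x ∈ win c), ∑ y, k c y x ≤ Γ)
    (hsum : ∀ x, ℓ x ≠ 0 → ∑ c ∈ Finset.univ.filter (fun c => x ∈ win c), ∑ y, k c y x ≤
      γ₀ * (Finset.univ.filter fun c => x ∈ win c).card)
    (hself : ∀ x, x ∈ win x) (m : ℕ) (x : ι) :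
    step^[m] (fun _ => R) x ≤ R * ((1 + ε * (2 * Γ + 1) / Fintype.card ι) ^ m * θ ^ ℓ x +
      (1 - ε * (1 - γ₀) / Fintype.card ι) ^ m) := by
  -- adapted from `DobrushinShlosman.iterate_step_le` (growth budget `γ₀ N⋆` ↦ `Γ`; `hsum` only in the bulk)
  have hθ0 : 0 ≤ θ := hγ₀.trans hθ
  have hιpos : (0 : ℝ) < Fintype.card ι := by exact_mod_cast Fintype.card_pos_iff.2 ⟨x⟩
  set q : ℝ := ε / Fintype.card ι with hq
  have hq0 : 0 ≤ q := div_nonneg hε0 hιpos.le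
  set G : ℝ := 1 + ε * (2 * Γ + 1) / Fintype.card ι with hG
  set β : ℝ := 1 - ε * (1 - γ₀) / Fintype.card ι with hβ
  have hGq : G = 1 + q * (2 * Γ + 1) := by rw [hG, hq]; ring
  have hβq : β = 1 - q * (1 - γ₀) := by rw [hβ, hq]; ring
  have hG1 : 1 ≤ G := by rw [hGq, le_add_iff_nonneg_right]; positivity
  have hq1 : q * (1 - γ₀) ≤ 1 := by
    rw [hq, div_mul_eq_mul_div, div_le_one hιpos]
    have h1 : ε * (1 - γ₀) ≤ 1 := by nlinarith
    exact h1.trans (by exact_mod_cast Fintype.card_pos_iff.2 ⟨x⟩)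
  have hβ0 : 0 ≤ β := by rw [hβq]; linarith
  have hβ1 : β ≤ 1 := by rw [hβq, sub_le_self_iff]; exact mul_nonneg hq0 (by linarith)
  induction m generalizing x with
  | zero =>
    simp only [Function.iterate_zero, id_eq, pow_zero, one_mul]
    nlinarith [pow_nonneg hθ0 (ℓ x)]
  | succ m ih =>
    rw [Function.iterate_succ_apply']
    set b := step^[m] fun _ => R with hb
    have hGm1 : 1 ≤ G ^ m := one_le_pow₀ hG1
    have hβm1 : β ^ m ≤ 1 := pow_le_one₀ hβ0 hβ1
    have hβm0 : 0 ≤ β ^ m := pow_nonneg hβ0 m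
    have hNx1 : (1 : ℝ) ≤ (Finset.univ.filter fun c => x ∈ win c).card := by
      have h : 1 ≤ (Finset.univ.filter fun c => x ∈ win c).card :=
        Finset.card_pos.2 ⟨x, Finset.mem_filter.2 ⟨Finset.mem_univ _, hself x⟩⟩
      exact_mod_cast h
    have hwx : 0 ≤ 1 - ε * (U.filter fun c => x ∈ win c).card / Fintype.card ι :=
      step_weight_nonneg _ hε1
    rcases Nat.eq_zero_or_pos (ℓ x) with hx0 | hxpos
    · -- zone `ℓ = 0`: growth budget from the crude bound `Γ`
      have hS0 : 0 ≤ R * (G ^ m + β ^ m) := mul_nonneg hR (by linarith)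
      have hS : ∀ c ∈ U, x ∈ win c → ∀ y, k c y x ≠ 0 → b y ≤ R * (G ^ m + β ^ m) := by
        intro c _ _ y _
        refine (ih y).trans (mul_le_mul_of_nonneg_left ?_ hR)
        nlinarith [pow_le_one₀ hθ0 hθ1 (n := ℓ y),
          mul_nonneg (zero_le_one.trans hGm1) (pow_nonneg hθ0 (ℓ y))]
      have hstep' := step_le_of_received_le hk hε0 hstep b x (hsum0 x) hS0 hS
      rw [← hq] at hstep'
      have h1 : (1 - ε * (U.filter fun c => x ∈ win c).card / Fintype.card ι) * b x ≤
          R * (G ^ m + β ^ m) := by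
        have hb0 : 0 ≤ b x := iterate_step_nonneg hk hε0 hε1 hstep hR m x
        have hwx1 : 1 - ε * (U.filter fun c => x ∈ win c).card / Fintype.card ι ≤ 1 := by
          rw [sub_le_self_iff]; positivity
        calc _ ≤ 1 * b x := mul_le_mul_of_nonneg_right hwx1 hb0
          _ ≤ R * (G ^ m * θ ^ ℓ x + β ^ m) := by rw [one_mul]; exact ih x
          _ = R * (G ^ m + β ^ m) := by rw [hx0, pow_zero, mul_one]
      rw [hx0, pow_zero, mul_one, pow_succ, pow_succ]
      exact zone_zero_ineq_bulk hR hq0 hγ₀ hΓ hGm1 hβm0 hβm1 hGq hβq hstep' h1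
    · -- zone `ℓ ≥ 1`: all centres usable, the averaged received sum contracts along the profile
      obtain ⟨L, hL⟩ : ∃ L, ℓ x = L + 1 := ⟨ℓ x - 1, by omega⟩
      have hxU : (U.filter fun c => x ∈ win c) = Finset.univ.filter fun c => x ∈ win c := by
        ext c
        simp only [Finset.mem_filter, Finset.mem_univ, true_and]
        exact ⟨fun h => h.2, fun h => ⟨hU x (by omega) c h, h⟩⟩
      have hS0 : 0 ≤ R * (G ^ m * θ ^ L + β ^ m) :=
        mul_nonneg hR (add_nonneg (mul_nonneg (zero_le_one.trans hGm1) (pow_nonneg hθ0 L)) hβm0)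
      have hS : ∀ c ∈ U, x ∈ win c → ∀ y, k c y x ≠ 0 → b y ≤ R * (G ^ m * θ ^ L + β ^ m) := by
        intro c _ hxc y hk0
        refine (ih y).trans (mul_le_mul_of_nonneg_left ?_ hR)
        have : θ ^ ℓ y ≤ θ ^ L :=
          pow_le_pow_of_le_one hθ0 hθ1 (by have := hℓ c x y hxc hk0; omega)
        nlinarith [this, zero_le_one.trans hGm1]
      have hstep' := step_le_of_received_le hk hε0 hstep b x (hsum x (by omega)) hS0 hS
      rw [hxU, ← hq] at hstep'
      have e : 1 - ε * (Finset.univ.filter fun c => x ∈ win c).card / Fintype.card ι =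
          1 - q * (Finset.univ.filter fun c => x ∈ win c).card := by
        rw [hq]; ring
      rw [hxU, e] at hwx
      rw [e] at hstep'
      have hbx : b x ≤ R * (G ^ m * (θ ^ L * θ) + β ^ m) := by
        have := ih x; rwa [hL, pow_succ] at this
      rw [hL, pow_succ, pow_succ, pow_succ]
      exact zone_pos_ineq hR hq0 hθ hγ₁ hNx1 hwx (zero_le_one.trans hGm1) (pow_nonneg hθ0 L) hθ0
        hG1 hβm0 hβq hstep' hbx

/-! ### The comparison theorem, bulk form -/

/-- ★ **The window comparison theorem under the averaged condition in the bulk only**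
(Dobrushin–Shlosman 1985 in Föllmer's dual-Lipschitz bookkeeping; the form needed by the infinite-volume
wrappers with genuine windows only): for two monotone-normalised functionals invariant under the usable window
operators, window dusting data (`hlip0`, `hosc`, `hT`, `hdust`), a crude received-sum bound `Γ ≥ 0` at every
cell, the averaged received-sum hypothesis with ratio `γ₀ ∈ [0, 1)` at the cells of positive profile, every
cell in its own window and a profile `ℓ` as in `iterate_step_le_bulk`, every admissible `F` whose Lipschitz
vector `δ` lives on cells of profile `≥ L₀` satisfies
`|E₁ F − E₂ F| ≤ 2 R e^{−κ L₀} Σ_x δ x`, `κ = (1−γ₀)²/(2(2Γ+1))` — constants free of `|ι|`.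
[cite: DobrushinShlosman1985, Theorem] -/
theorem abs_sub_le_exp_bulk (hR : 0 ≤ R) (hlip0 : ∀ ⦃F : Ω → ℝ⦄ ⦃δ : ι → ℝ⦄, Lip F δ → ∀ x, 0 ≤ δ x)
    (hosc : ∀ ⦃F : Ω → ℝ⦄ ⦃δ : ι → ℝ⦄, Adm F → Lip F δ → ∀ σ τ, |F σ - F τ| ≤ R * ∑ x, δ x)
    (hk : ∀ c y x, 0 ≤ k c y x) (hT : ∀ ⦃F : Ω → ℝ⦄ (c : ι), Adm F → Adm (T c F))
    (hdust : ∀ ⦃F : Ω → ℝ⦄ ⦃δ : ι → ℝ⦄ (c : ι), Adm F → Lip F δ →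
      Lip (T c F) fun y => if y ∈ win c then 0 else δ y + ∑ x ∈ win c, k c y x * δ x)
    (h₁le : ∀ ⦃F : Ω → ℝ⦄ ⦃M : ℝ⦄, Adm F → (∀ σ, F σ ≤ M) → E₁ F ≤ M)
    (h₁ge : ∀ ⦃F : Ω → ℝ⦄ ⦃M : ℝ⦄, Adm F → (∀ σ, M ≤ F σ) → M ≤ E₁ F)
    (h₁T : ∀ ⦃F : Ω → ℝ⦄ (c : ι), c ∈ U → Adm F → E₁ (T c F) = E₁ F)
    (h₂le : ∀ ⦃F : Ω → ℝ⦄ ⦃M : ℝ⦄, Adm F → (∀ σ, F σ ≤ M) → E₂ F ≤ M)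
    (h₂ge : ∀ ⦃F : Ω → ℝ⦄ ⦃M : ℝ⦄, Adm F → (∀ σ, M ≤ F σ) → M ≤ E₂ F)
    (h₂T : ∀ ⦃F : Ω → ℝ⦄ (c : ι), c ∈ U → Adm F → E₂ (T c F) = E₂ F)
    {γ₀ Γ : ℝ} (hγ₀ : 0 ≤ γ₀) (hγ₁ : γ₀ < 1) (hΓ : 0 ≤ Γ) (ℓ : ι → ℕ)
    (hU : ∀ x, ℓ x ≠ 0 → ∀ c, x ∈ win c → c ∈ U)
    (hℓ : ∀ c x y, x ∈ win c → k c y x ≠ 0 → ℓ x ≤ ℓ y + 1)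
    (hsum0 : ∀ x, ∑ c ∈ Finset.univ.filter (fun c => x ∈ win c), ∑ y, k c y x ≤ Γ)
    (hsum : ∀ x, ℓ x ≠ 0 → ∑ c ∈ Finset.univ.filter (fun c => x ∈ win c), ∑ y, k c y x ≤
      γ₀ * (Finset.univ.filter fun c => x ∈ win c).card)
    (hself : ∀ x, x ∈ win x)
    (L₀ : ℕ) {F : Ω → ℝ} {δ : ι → ℝ} (hF : Adm F) (hδ : Lip F δ) (hδ0 : ∀ x, ℓ x < L₀ → δ x = 0) :
    |E₁ F - E₂ F| ≤
      2 * R * Real.exp (-((1 - γ₀) ^ 2 / (2 * (2 * Γ + 1)) * L₀)) * ∑ x, δ x := by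
  -- adapted from `DobrushinShlosman.abs_sub_le_exp` (`2 γ₀ N⋆ + 1` ↦ `2 Γ + 1`)
  set A : ℝ := 2 * Γ + 1 with hA
  have hA1 : 1 ≤ A := by rw [hA]; linarith
  set ε : ℝ := (1 - γ₀) / (2 * A) with hε
  have hε0 : 0 ≤ ε := by rw [hε]; exact div_nonneg (by linarith) (by linarith)
  have hε1 : ε ≤ 1 := by rw [hε, div_le_one (by linarith)]; linarith
  set θ : ℝ := Real.exp (γ₀ - 1) with hθ
  have hθγ : γ₀ ≤ θ := by have := Real.add_one_le_exp (γ₀ - 1); rw [hθ]; linarith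
  have hθ1 : θ ≤ 1 := by rw [hθ]; exact Real.exp_le_one_iff.2 (by linarith)
  set m : ℕ := Fintype.card ι * L₀ with hm
  set step : (ι → ℝ) → ι → ℝ := fun a x => (1 - ε * U.card / Fintype.card ι) * a x +
    ε / Fintype.card ι * ∑ c ∈ U, (if x ∈ win c then ∑ y, k c y x * a y else a x)
  have hstep : ∀ a x, step a x = (1 - ε * U.card / Fintype.card ι) * a x +
      ε / Fintype.card ι * ∑ c ∈ U, (if x ∈ win c then ∑ y, k c y x * a y else a x) := fun a x => rfl
  refine (iterate_estimate hR hlip0 hosc hk hT hdust h₁le h₁ge h₁T h₂le h₂ge h₂T hε0 hε1 hstep m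
    hF hδ).trans ?_
  rw [Finset.mul_sum]
  refine Finset.sum_le_sum fun x _ => ?_
  by_cases hx : ℓ x < L₀
  · rw [hδ0 x hx, mul_zero, mul_zero]
  replace hx : L₀ ≤ ℓ x := not_lt.1 hx
  refine mul_le_mul_of_nonneg_right ?_ (hlip0 hδ x)
  refine (iterate_step_le_bulk hR hk hγ₀ hγ₁.le hθγ hθ1 hε0 hε1 hΓ hstep ℓ hU hℓ hsum0 hsum hself m
    x).trans ?_
  have hιpos : (0 : ℝ) < Fintype.card ι := by exact_mod_cast Fintype.card_pos_iff.2 ⟨x⟩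
  have hθ0 : 0 ≤ θ := hγ₀.trans hθγ
  have hmε : (m : ℝ) * (ε * A / Fintype.card ι) = L₀ * ((1 - γ₀) / 2) := by
    rw [hm, hε]; field_simp; push_cast; ring
  have hGexp : (1 + ε * (2 * Γ + 1) / Fintype.card ι) ^ m ≤ Real.exp (L₀ * ((1 - γ₀) / 2)) := by
    have h1 : 1 + ε * (2 * Γ + 1) / Fintype.card ι ≤ Real.exp (ε * A / Fintype.card ι) := by
      have := Real.add_one_le_exp (ε * A / Fintype.card ι); rw [← hA]; linarith
    refine (pow_le_pow_left₀ (by rw [← hA]; positivity) h1 m).trans (le_of_eq ?_)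
    rw [← Real.exp_nat_mul, hmε]
  have hθpow : θ ^ ℓ x ≤ Real.exp (L₀ * (γ₀ - 1)) := by
    refine (pow_le_pow_of_le_one hθ0 hθ1 hx).trans (le_of_eq ?_)
    rw [hθ, ← Real.exp_nat_mul]
  have hrate : (1 - γ₀) ^ 2 / (2 * (2 * Γ + 1)) * L₀ ≤ L₀ * ((1 - γ₀) / 2) := by
    have hr : (1 - γ₀) ^ 2 / (2 * (2 * Γ + 1)) ≤ (1 - γ₀) / 2 := by
      rw [← hA, div_le_div_iff₀ (by linarith) (by norm_num : (0:ℝ) < 2)]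
      nlinarith
    nlinarith [Nat.cast_nonneg (α := ℝ) L₀]
  have hT1 : (1 + ε * (2 * Γ + 1) / Fintype.card ι) ^ m * θ ^ ℓ x ≤
      Real.exp (-((1 - γ₀) ^ 2 / (2 * (2 * Γ + 1)) * L₀)) := by
    calc _ ≤ Real.exp (L₀ * ((1 - γ₀) / 2)) * Real.exp (L₀ * (γ₀ - 1)) :=
          mul_le_mul hGexp hθpow (pow_nonneg hθ0 _) (Real.exp_pos _).le
      _ = Real.exp (-(L₀ * ((1 - γ₀) / 2))) := by rw [← Real.exp_add]; congr 1; ring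
      _ ≤ _ := Real.exp_le_exp.2 (by linarith)
  have hT2 : (1 - ε * (1 - γ₀) / Fintype.card ι) ^ m ≤
      Real.exp (-((1 - γ₀) ^ 2 / (2 * (2 * Γ + 1)) * L₀)) := by
    have h0 : 0 ≤ 1 - ε * (1 - γ₀) / Fintype.card ι := by
      rw [sub_nonneg, div_le_one hιpos]
      have : ε * (1 - γ₀) ≤ 1 := by nlinarith
      exact this.trans (by exact_mod_cast Fintype.card_pos_iff.2 ⟨x⟩)
    refine (pow_le_pow_left₀ h0 (Real.one_sub_le_exp_neg _) m).trans (le_of_eq ?_)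
    rw [← Real.exp_nat_mul]
    congr 1
    rw [hm, ← hA, hε]; field_simp; push_cast; ring
  calc R * ((1 + ε * (2 * Γ + 1) / Fintype.card ι) ^ m * θ ^ ℓ x +
        (1 - ε * (1 - γ₀) / Fintype.card ι) ^ m)
      ≤ R * (Real.exp (-((1 - γ₀) ^ 2 / (2 * (2 * Γ + 1)) * L₀)) +
          Real.exp (-((1 - γ₀) ^ 2 / (2 * (2 * Γ + 1)) * L₀))) :=
        mul_le_mul_of_nonneg_left (add_le_add hT1 hT2) hR
    _ = 2 * R * Real.exp (-((1 - γ₀) ^ 2 / (2 * (2 * Γ + 1)) * L₀)) := by ring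

end Literature.Probability.LatticeModels.DobrushinShlosman

end
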